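import Mathlib.Algebra.Polynomial.Roots
import Mathlib.Algebra.Polynomial.Degree.Support
import Mathlib.Order.Interval.Set.Infinite
import Mathlib.Tactic.ComputeDegree
import Literature.InformationTheory.QuantumCodes.AdditiveMacWilliams
import HarnessLib

/-!
# The MacWilliams and shadow transforms on their eigenbasis `(x+y)^{n−a}(x−3y)^a` — polynomial lemmas

Topic `Literature/InformationTheory/QuantumCodes` (venture QEC, cell `qec`, PARTITION row 06; LADDER-QEC rung X1).
Second engine file for the shadow-enumerator distance bounds of [Rains1998Shadow, Thms. 6 and 9] /
[Rains1999Shadow, Thm. 15]. We dehomogenise degree-`n` enumerators `A(x,y) = Σ_r A_r x^{n−r} y^r` at `x = 1`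
(polynomials `D(y) = Σ_r A_r y^r` of degree `≤ n` over `ℝ`) and type, as `ℝ`-linear maps on `ℝ[y]`:
* `macT n`: the MacWilliams transform `A ↦ A((x+3y)/2, (x−y)/2)`, i.e. `D ↦ 2^{−n} Σ_r A_r (1+3y)^{n−r}(1−y)^r`
  — its coefficients are Rains's dual enumerator `B_j = 2^{−n} Σ_r P_j(r,n) A_r` (`rainsDual`)
  [Rains1999Shadow, Thm. 10; Rains1998Shadow, §V «B(x,y) = 2^r A((x+3y)/2,(x−y)/2)»];
* `shT n`: the shadow transform `A ↦ A((x+3y)/2, (y−x)/2)`, i.e. `D ↦ 2^{−n} Σ_r A_r (1+3y)^{n−r}(y−1)^r` — its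
  coefficients are Rains's shadow enumerator `S_j = 2^{−n} Σ_r (−1)^r P_j(r,n) A_r` (`rainsShadow`)
  [Rains1999Shadow, Thm. 10; Rains1998Shadow, Thm. 2 «S(x,y) = |C|^{−1} A(x+3y, y−x)»].
Main facts (proved): on the basis `eigVec n a = (1+y)^{n−a}(1−3y)^a` (dehomogenised `(x+y)^{n−a}(x−3y)^a`) the
MacWilliams transform acts by `(−1)^a` (`macT_eigVec`) — this is the invariant/anti-invariant splitting behind
Thms. 4 and 7 of [Rains1998Shadow] («Δ(x,y) is taken to its negative by the MacWilliams transform … This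
forces Δ to be in the ring (x−3y)ℂ[x+y, y(x−y)]») — and the shadow transform sends it to `2^n y^{n−a}`
(`shT_eigVec`); every polynomial of degree `≤ n` lies in the span of the `eigVec n a`, `a ≤ n`
(`mem_span_eigVec`, from `4 = 3(1+y) + (1−3y)`, `4y = (1+y) − (1−3y)`). Both transform identities are proved by
evaluating at real points `y > 0` and `Polynomial.eq_of_infinite_eval_eq`.

References: E. M. Rains, IEEE Trans. Inform. Theory 44 (1998) 134–139 [Rains1998Shadow]; 45 (1999) 2361–2366
[Rains1999Shadow]. The quaternary Krawtchouk generating function `coeff_krawtchouk4Gen` is qec-type-01's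
(`AdditiveMacWilliams.lean`), imported.
-/

namespace Literature.InformationTheory.QuantumCodes

open Finset Polynomial

noncomputable section

namespace ShadowBound

/-! ### The transforms -/

/-- The `r`-th MacWilliams term `(1+3y)^{n−r}(1−y)^r` (dehomogenised `(x+3y)^{n−r}(x−y)^r`); its `y^j`
coefficient is the quaternary Krawtchouk value `P_j(r,n)`. Column: definition (auxiliary).
[cite: Rains1999Shadow, Thm. 10 p. 2364; CalderbankEtAl1998, §7 before Thm. 21] -/
def mwTerm (n r : ℕ) : ℝ[X] := (1 + 3 * X) ^ (n - r) * (1 - X) ^ r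

/-- The `r`-th shadow term `(1+3y)^{n−r}(y−1)^r` (dehomogenised `(x+3y)^{n−r}(y−x)^r`). Column: definition
(auxiliary). [cite: Rains1998Shadow, Thm. 2 p. 135; Rains1999Shadow, Thm. 10 p. 2364] -/
def shTerm (n r : ℕ) : ℝ[X] := (1 + 3 * X) ^ (n - r) * (X - 1) ^ r

/-- **The MacWilliams transform** `A(x,y) ↦ A((x+3y)/2, (x−y)/2)` on degree-`n` enumerators, dehomogenised:
`D = Σ_r A_r y^r ↦ 2^{−n} Σ_{r ≤ n} A_r (1+3y)^{n−r}(1−y)^r`, as an `ℝ`-linear map. Column: definition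
(auxiliary). [cite: Rains1998Shadow, §V p. 138 («B(x,y) = 2^r A((x+3y)/2,(x−y)/2)», «Δ = A(x,y) − A((x+3y)/2,(x−y)/2)»)] -/
def macT (n : ℕ) : ℝ[X] →ₗ[ℝ] ℝ[X] :=
  ∑ r ∈ range (n + 1), (lcoeff ℝ r).smulRight (C ((2 : ℝ)⁻¹ ^ n) * mwTerm n r)

/-- **The shadow transform** `A(x,y) ↦ A((x+3y)/2, (y−x)/2)` on degree-`n` enumerators, dehomogenised:
`D = Σ_r A_r y^r ↦ 2^{−n} Σ_{r ≤ n} A_r (1+3y)^{n−r}(y−1)^r`, as an `ℝ`-linear map. Column: definition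
(auxiliary). [cite: Rains1998Shadow, Thm. 2 p. 135 and §V p. 138 («Σ(x,y) = 2^{r−1} Δ((x+3y)/2,(y−x)/2)»)] -/
def shT (n : ℕ) : ℝ[X] →ₗ[ℝ] ℝ[X] :=
  ∑ r ∈ range (n + 1), (lcoeff ℝ r).smulRight (C ((2 : ℝ)⁻¹ ^ n) * shTerm n r)

/-- **The eigenbasis**: `eigVec n a = (1+y)^{n−a}(1−3y)^a`, the dehomogenisation of `(x+y)^{n−a}(x−3y)^a`
(`x+y` is fixed and `x−3y` negated by the MacWilliams substitution). Column: definition (auxiliary).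
[cite: Rains1998Shadow, Thms. 4 and 7 pp. 135, 138 (the rings ℂ[x+y, y(x−y)] and (x−3y)ℂ[x+y, y(x−y)])] -/
def eigVec (n a : ℕ) : ℝ[X] := (1 + X) ^ (n - a) * (1 - 3 * X) ^ a

/-- `macT` as a finite sum. [cite: Rains1998Shadow, §V p. 138] -/
theorem macT_apply (n : ℕ) (D : ℝ[X]) :
    macT n D = ∑ r ∈ range (n + 1), C (D.coeff r * 2⁻¹ ^ n) * mwTerm n r := by
  simp only [macT, LinearMap.sum_apply, LinearMap.smulRight_apply, lcoeff_apply, smul_eq_C_mul, map_mul,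
    mul_assoc]

/-- `shT` as a finite sum. [cite: Rains1998Shadow, Thm. 2 p. 135] -/
theorem shT_apply (n : ℕ) (D : ℝ[X]) :
    shT n D = ∑ r ∈ range (n + 1), C (D.coeff r * 2⁻¹ ^ n) * shTerm n r := by
  simp only [shT, LinearMap.sum_apply, LinearMap.smulRight_apply, lcoeff_apply, smul_eq_C_mul, map_mul,
    mul_assoc]

/-! ### Coefficients: Krawtchouk values -/

/-- `[y^j](1+3y)^{n−r}(1−y)^r = P_j(r,n)` (real form of `coeff_krawtchouk4Gen`).
[cite: Rains1999Shadow, Thm. 10 p. 2364 (definition of P_j(x,n))] -/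
theorem coeff_mwTerm (n r j : ℕ) : (mwTerm n r).coeff j = (krawtchouk4 n j r : ℝ) := by
  have h := congrArg (Int.cast : ℤ → ℝ) (coeff_krawtchouk4Gen n j r)
  rw [← h, ← eq_intCast (Int.castRingHom ℝ), ← coeff_map]
  congr 1
  rw [mwTerm, mul_comm]
  simp

/-- `[y^j](1+3y)^{n−r}(y−1)^r = (−1)^r P_j(r,n)`. [cite: Rains1999Shadow, Thm. 10 p. 2364 (sixth line)] -/
theorem coeff_shTerm (n r j : ℕ) : (shTerm n r).coeff j = (-1) ^ r * (krawtchouk4 n j r : ℝ) := by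
  rw [← coeff_mwTerm, ← coeff_C_mul, shTerm, mwTerm, show (X - 1 : ℝ[X]) = -(1 - X) by ring, neg_pow,
    map_pow, map_neg, map_one]
  ring

/-- Coefficients of the MacWilliams transform: `[y^j] macT D = 2^{−n} Σ_{r ≤ n} P_j(r,n) D_r`.
[cite: Rains1999Shadow, Thm. 10 p. 2364 («B_i = 2^{−n} Σ_r P_i(r,n) A_r»)] -/
theorem coeff_macT (n : ℕ) (D : ℝ[X]) (j : ℕ) :
    (macT n D).coeff j = 2⁻¹ ^ n * ∑ r ∈ range (n + 1), (krawtchouk4 n j r : ℝ) * D.coeff r := by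
  rw [macT_apply, finsetSum_coeff, mul_sum]
  refine sum_congr rfl fun r _ => ?_
  rw [coeff_C_mul, coeff_mwTerm]; ring

/-- Coefficients of the shadow transform: `[y^j] shT D = 2^{−n} Σ_{r ≤ n} (−1)^r P_j(r,n) D_r`.
[cite: Rains1999Shadow, Thm. 10 p. 2364 («S_i = 2^{−n} Σ_r (−1)^r P_i(r,n) A_r»)] -/
theorem coeff_shT (n : ℕ) (D : ℝ[X]) (j : ℕ) :
    (shT n D).coeff j = 2⁻¹ ^ n * ∑ r ∈ range (n + 1), (-1) ^ r * (krawtchouk4 n j r : ℝ) * D.coeff r := by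
  rw [shT_apply, finsetSum_coeff, mul_sum]
  refine sum_congr rfl fun r _ => ?_
  rw [coeff_C_mul, coeff_shTerm]; ring

/-- The polynomial `Σ_{r ≤ n} A_r y^r` of a coefficient sequence. Column: definition (auxiliary).
[cite: Rains1998Shadow, §IV–V p. 138 («A(1,y) = Σ_j a_j y^j»)] -/
def ofCoeffs (n : ℕ) (A : ℕ → ℝ) : ℝ[X] := ∑ r ∈ range (n + 1), C (A r) * X ^ r

/-- Coefficients of `ofCoeffs`. [cite: Rains1998Shadow, §IV p. 138] -/
theorem coeff_ofCoeffs (n : ℕ) (A : ℕ → ℝ) (j : ℕ) : (ofCoeffs n A).coeff j = if j ≤ n then A j else 0 := by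
  rw [ofCoeffs, finsetSum_coeff]
  simp_rw [coeff_C_mul_X_pow]
  rw [sum_ite_eq]
  simp only [mem_range, Nat.lt_succ_iff]

/-- `natDegree (ofCoeffs n A) ≤ n`. [cite: Rains1998Shadow, §IV p. 138] -/
theorem natDegree_ofCoeffs_le (n : ℕ) (A : ℕ → ℝ) : (ofCoeffs n A).natDegree ≤ n := by
  rw [ofCoeffs]
  refine natDegree_sum_le_of_forall_le _ _ fun r hr => ?_
  rw [mem_range] at hr
  exact (natDegree_C_mul_X_pow_le _ _).trans (by omega)

/-- The MacWilliams transform of a coefficient sequence has Rains's dual enumerator `B_j` as coefficients.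
[cite: Rains1999Shadow, Thm. 10 p. 2364] -/
theorem coeff_macT_ofCoeffs (n : ℕ) (A : ℕ → ℝ) (j : ℕ) :
    (macT n (ofCoeffs n A)).coeff j = rainsDual n A j := by
  rw [coeff_macT, rainsDual, one_div, inv_pow]
  congr 1
  refine sum_congr rfl fun r hr => ?_
  rw [mem_range] at hr
  rw [coeff_ofCoeffs, if_pos (by omega)]

/-- The shadow transform of a coefficient sequence has Rains's shadow enumerator `S_j` as coefficients.
[cite: Rains1999Shadow, Thm. 10 p. 2364] -/
theorem coeff_shT_ofCoeffs (n : ℕ) (A : ℕ → ℝ) (j : ℕ) :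
    (shT n (ofCoeffs n A)).coeff j = rainsShadow n A j := by
  rw [coeff_shT, rainsShadow, one_div, inv_pow]
  congr 1
  refine sum_congr rfl fun r hr => ?_
  rw [mem_range] at hr
  rw [coeff_ofCoeffs, if_pos (by omega)]

/-! ### Degrees -/

/-- `natDegree (eigVec n a) ≤ n` for `a ≤ n`. [cite: Rains1998Shadow, Thm. 7 p. 138] -/
theorem natDegree_eigVec_le {n a : ℕ} (ha : a ≤ n) : (eigVec n a).natDegree ≤ n := by
  unfold eigVec
  refine (natDegree_mul_le).trans ?_
  refine (add_le_add (natDegree_pow_le) (natDegree_pow_le)).trans ?_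
  have h1 : (1 + X : ℝ[X]).natDegree ≤ 1 := by compute_degree
  have h2 : (1 - 3 * X : ℝ[X]).natDegree ≤ 1 := by compute_degree
  calc (n - a) * (1 + X : ℝ[X]).natDegree + a * (1 - 3 * X : ℝ[X]).natDegree
      ≤ (n - a) * 1 + a * 1 := add_le_add (Nat.mul_le_mul_left _ h1) (Nat.mul_le_mul_left _ h2)
    _ = n := by omega

/-- `natDegree (macT n D) ≤ n`. [cite: Rains1998Shadow, §V p. 138] -/
theorem natDegree_macT_le (n : ℕ) (D : ℝ[X]) : (macT n D).natDegree ≤ n := by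
  rw [macT_apply]
  refine natDegree_sum_le_of_forall_le _ _ fun r hr => ?_
  rw [mem_range] at hr
  refine natDegree_C_mul_le _ _ |>.trans ?_
  unfold mwTerm
  refine (natDegree_mul_le).trans ?_
  refine (add_le_add (natDegree_pow_le) (natDegree_pow_le)).trans ?_
  have h1 : (1 + 3 * X : ℝ[X]).natDegree ≤ 1 := by compute_degree
  have h2 : (1 - X : ℝ[X]).natDegree ≤ 1 := by compute_degree
  calc (n - r) * (1 + 3 * X : ℝ[X]).natDegree + r * (1 - X : ℝ[X]).natDegree
      ≤ (n - r) * 1 + r * 1 := add_le_add (Nat.mul_le_mul_left _ h1) (Nat.mul_le_mul_left _ h2)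
    _ = n := by omega

/-! ### The transforms on the eigenbasis (evaluation at real points) -/

/-- Evaluation of `macT D` at a real point. [cite: Rains1998Shadow, §V p. 138] -/
theorem eval_macT (n : ℕ) (D : ℝ[X]) (y : ℝ) :
    (macT n D).eval y = ∑ r ∈ range (n + 1), D.coeff r * 2⁻¹ ^ n * ((1 + 3 * y) ^ (n - r) * (1 - y) ^ r) := by
  simp [macT_apply, mwTerm, eval_finsetSum]

/-- Evaluation of `shT D` at a real point. [cite: Rains1998Shadow, Thm. 2 p. 135] -/
theorem eval_shT (n : ℕ) (D : ℝ[X]) (y : ℝ) :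
    (shT n D).eval y = ∑ r ∈ range (n + 1), D.coeff r * 2⁻¹ ^ n * ((1 + 3 * y) ^ (n - r) * (y - 1) ^ r) := by
  simp [shT_apply, shTerm, eval_finsetSum]

/-- The substitution step: for `y > 0` and a polynomial `D` of degree `≤ n`,
`Σ_{r ≤ n} D_r 2^{−n} (1+3y)^{n−r} (c(y))^r = 2^{−n}(1+3y)^n · D(c(y)/(1+3y))`. [folklore] -/
private theorem sum_coeff_mul_pow_eq_eval {n : ℕ} {D : ℝ[X]} (hD : D.natDegree ≤ n) (y c : ℝ) (hy : 0 < y) :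
    ∑ r ∈ range (n + 1), D.coeff r * 2⁻¹ ^ n * ((1 + 3 * y) ^ (n - r) * c ^ r)
      = 2⁻¹ ^ n * (1 + 3 * y) ^ n * D.eval (c / (1 + 3 * y)) := by
  have h3 : (1 + 3 * y) ≠ 0 := by positivity
  rw [eval_eq_sum_range' (Nat.lt_succ_of_le hD), mul_sum]
  refine sum_congr rfl fun r hr => ?_
  rw [mem_range] at hr
  rw [div_pow, show (1 + 3 * y) ^ n = (1 + 3 * y) ^ (n - r) * (1 + 3 * y) ^ r by
    rw [← pow_add, Nat.sub_add_cancel (by omega)]]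
  field_simp

/-- **The MacWilliams transform on its eigenbasis**: `macT n ((1+y)^{n−a}(1−3y)^a) = (−1)^a (1+y)^{n−a}(1−3y)^a`
— `x + y` is invariant and `x − 3y` anti-invariant under `(x,y) ↦ ((x+3y)/2,(x−y)/2)`.
[cite: Rains1998Shadow, Thm. 7 (proof) p. 138] -/
theorem macT_eigVec {n a : ℕ} (ha : a ≤ n) : macT n (eigVec n a) = C ((-1 : ℝ) ^ a) * eigVec n a := by
  apply eq_of_infinite_eval_eq
  refine Set.Infinite.mono (s := Set.Ioi (0 : ℝ)) (fun y hy => ?_) (Set.Ioi_infinite 0)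
  rw [Set.mem_Ioi] at hy
  rw [Set.mem_setOf_eq, eval_macT, sum_coeff_mul_pow_eq_eval (natDegree_eigVec_le ha) y (1 - y) hy]
  have h3 : (1 + 3 * y) ≠ 0 := by positivity
  set s := (1 - y) / (1 + 3 * y) with hs
  have e1 : (1 + 3 * y) * (1 + s) = 2 * (1 + y) := by rw [hs]; field_simp; ring
  have e2 : (1 + 3 * y) * (1 - 3 * s) = -2 * (1 - 3 * y) := by rw [hs]; field_simp; ring
  simp only [eigVec, eval_mul, eval_pow, eval_add, eval_sub, eval_one, eval_X, eval_C, eval_ofNat]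
  rw [show (1 + 3 * y) ^ n = (1 + 3 * y) ^ (n - a) * (1 + 3 * y) ^ a by rw [← pow_add, Nat.sub_add_cancel ha]]
  have hp1 : (1 + 3 * y) ^ (n - a) * (1 + s) ^ (n - a) = 2 ^ (n - a) * (1 + y) ^ (n - a) := by
    rw [← mul_pow, e1, mul_pow]
  have hp2 : (1 + 3 * y) ^ a * (1 - 3 * s) ^ a = (-1) ^ a * 2 ^ a * (1 - 3 * y) ^ a := by
    rw [← mul_pow, e2, show (-2 * (1 - 3 * y)) = (-1) * 2 * (1 - 3 * y) by ring, mul_pow, mul_pow]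
  have h2n : (2 : ℝ) ^ (n - a) * 2 ^ a = 2 ^ n := by rw [← pow_add, Nat.sub_add_cancel ha]
  calc 2⁻¹ ^ n * ((1 + 3 * y) ^ (n - a) * (1 + 3 * y) ^ a) * ((1 + s) ^ (n - a) * (1 - 3 * s) ^ a)
      = 2⁻¹ ^ n * (((1 + 3 * y) ^ (n - a) * (1 + s) ^ (n - a)) * ((1 + 3 * y) ^ a * (1 - 3 * s) ^ a)) := by
        ring
    _ = 2⁻¹ ^ n * ((2 ^ (n - a) * (1 + y) ^ (n - a)) * ((-1) ^ a * 2 ^ a * (1 - 3 * y) ^ a)) := by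
        rw [hp1, hp2]
    _ = (2⁻¹ ^ n * (2 ^ (n - a) * 2 ^ a)) * ((-1) ^ a * ((1 + y) ^ (n - a) * (1 - 3 * y) ^ a)) := by ring
    _ = (-1) ^ a * ((1 + y) ^ (n - a) * (1 - 3 * y) ^ a) := by
        rw [h2n, ← mul_pow, inv_mul_cancel₀ two_ne_zero, one_pow, one_mul]

/-- **The shadow transform on the eigenbasis**: `shT n ((1+y)^{n−a}(1−3y)^a) = 2^n y^{n−a}` — under
`(x,y) ↦ ((x+3y)/2,(y−x)/2)`, `x+y ↦ 2y` and `x−3y ↦ 2x`.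
[cite: Rains1998Shadow, Thm. 7 p. 138 («Σ(x,y) = Σ_i (−1)^i 2^{n−1+r−3i} e_i x y^{n−1−2i}(x²−y²)^i»)] -/
theorem shT_eigVec {n a : ℕ} (ha : a ≤ n) : shT n (eigVec n a) = C ((2 : ℝ) ^ n) * X ^ (n - a) := by
  apply eq_of_infinite_eval_eq
  refine Set.Infinite.mono (s := Set.Ioi (0 : ℝ)) (fun y hy => ?_) (Set.Ioi_infinite 0)
  rw [Set.mem_Ioi] at hy
  rw [Set.mem_setOf_eq, eval_shT, sum_coeff_mul_pow_eq_eval (natDegree_eigVec_le ha) y (y - 1) hy]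
  have h3 : (1 + 3 * y) ≠ 0 := by positivity
  set s := (y - 1) / (1 + 3 * y) with hs
  have e1 : (1 + 3 * y) * (1 + s) = 4 * y := by rw [hs]; field_simp; ring
  have e2 : (1 + 3 * y) * (1 - 3 * s) = 4 := by rw [hs]; field_simp; ring
  simp only [eigVec, eval_mul, eval_pow, eval_add, eval_sub, eval_one, eval_X, eval_C, eval_ofNat]
  rw [show (1 + 3 * y) ^ n = (1 + 3 * y) ^ (n - a) * (1 + 3 * y) ^ a by rw [← pow_add, Nat.sub_add_cancel ha]]
  have hp1 : (1 + 3 * y) ^ (n - a) * (1 + s) ^ (n - a) = 4 ^ (n - a) * y ^ (n - a) := by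
    rw [← mul_pow, e1, mul_pow]
  have hp2 : (1 + 3 * y) ^ a * (1 - 3 * s) ^ a = 4 ^ a := by rw [← mul_pow, e2]
  have h4n : (4 : ℝ) ^ (n - a) * 4 ^ a = 2 ^ n * 2 ^ n := by
    rw [← pow_add, Nat.sub_add_cancel ha, ← mul_pow]; norm_num
  calc 2⁻¹ ^ n * ((1 + 3 * y) ^ (n - a) * (1 + 3 * y) ^ a) * ((1 + s) ^ (n - a) * (1 - 3 * s) ^ a)
      = 2⁻¹ ^ n * (((1 + 3 * y) ^ (n - a) * (1 + s) ^ (n - a)) * ((1 + 3 * y) ^ a * (1 - 3 * s) ^ a)) := by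
        ring
    _ = 2⁻¹ ^ n * ((4 ^ (n - a) * y ^ (n - a)) * 4 ^ a) := by rw [hp1, hp2]
    _ = (2⁻¹ ^ n * (4 ^ (n - a) * 4 ^ a)) * y ^ (n - a) := by ring
    _ = 2 ^ n * y ^ (n - a) := by
        rw [h4n, ← mul_assoc, ← mul_pow, inv_mul_cancel₀ two_ne_zero, one_pow, one_mul]

/-! ### Spanning -/

/-- Expansion step for the spanning lemma: if every `c·u^p v^q` with `p + q = n` lies in a submodule `M`, then
so does `(3u + v)^m (u − v)^r` for `m + r = n` (two binomial expansions). [folklore] -/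
private theorem mul_pow_mem_of_products_mem {M : Submodule ℝ ℝ[X]} (u v : ℝ[X]) {n : ℕ}
    (h : ∀ p q : ℕ, p + q = n → ∀ c : ℝ, C c * (u ^ p * v ^ q) ∈ M) {m r : ℕ} (hmr : m + r = n) :
    (3 * u + v) ^ m * (u - v) ^ r ∈ M := by
  rw [sub_eq_add_neg, add_pow, add_pow, sum_mul_sum]
  refine Submodule.sum_mem _ fun i hi => Submodule.sum_mem _ fun j hj => ?_
  rw [mem_range] at hi hj
  have : (3 * u) ^ i * v ^ (m - i) * ((m.choose i : ℕ) : ℝ[X]) * (u ^ j * (-v) ^ (r - j) * ((r.choose j : ℕ) : ℝ[X]))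
      = C ((3 : ℝ) ^ i * (m.choose i : ℕ) * (-1) ^ (r - j) * (r.choose j : ℕ))
        * (u ^ (i + j) * v ^ ((m - i) + (r - j))) := by
    simp only [map_mul, map_pow, map_natCast, map_neg, map_one, map_ofNat]
    rw [neg_pow, mul_pow, pow_add, pow_add]
    ring
  rw [this]
  exact h _ _ (by omega) _

/-- **Spanning**: every real polynomial of degree `≤ n` is a linear combination of the `(1+y)^{n−a}(1−3y)^a`,
`a ≤ n` (since `4 = 3(1+y) + (1−3y)` and `4y = (1+y) − (1−3y)`). This is the finite-dimensional content of
«the Molien series of the ring of anti-invariants … we have exhausted the space of anti-invariants».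
[cite: Rains1998Shadow, Thm. 7 (proof) p. 138] -/
theorem mem_span_eigVec {n : ℕ} {D : ℝ[X]} (hD : D.natDegree ≤ n) :
    D ∈ Submodule.span ℝ (eigVec n '' {a | a ≤ n}) := by
  set M := Submodule.span ℝ (eigVec n '' {a | a ≤ n}) with hM
  have hpq : ∀ p q : ℕ, p + q = n → ∀ c : ℝ, C c * ((1 + X) ^ p * (1 - 3 * X) ^ q) ∈ M := by
    intro p q hpq c
    rw [← smul_eq_C_mul]
    refine Submodule.smul_mem _ _ (Submodule.subset_span ⟨q, ?_, ?_⟩)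
    · show q ≤ n; omega
    · rw [eigVec, show n - q = p by omega]
  have hX : ∀ r, r ≤ n → (X : ℝ[X]) ^ r ∈ M := by
    intro r hr
    have h4 : (3 : ℝ[X]) * (1 + X) + (1 - 3 * X) = C 4 := by
      rw [show (C 4 : ℝ[X]) = 4 from map_ofNat C 4]; ring
    have h4X : (1 + X : ℝ[X]) - (1 - 3 * X) = C 4 * X := by
      rw [show (C 4 : ℝ[X]) = 4 from map_ofNat C 4]; ring
    have key : C ((4 : ℝ) ^ n) * X ^ r = (3 * (1 + X) + (1 - 3 * X)) ^ (n - r) * ((1 + X) - (1 - 3 * X)) ^ r := by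
      rw [h4, h4X, mul_pow, ← mul_assoc, ← map_pow, ← map_pow, ← map_mul, ← pow_add,
        Nat.sub_add_cancel hr]
    have hXr : (X : ℝ[X]) ^ r = ((4 : ℝ) ^ n)⁻¹ • (C ((4 : ℝ) ^ n) * X ^ r) := by
      rw [smul_eq_C_mul, ← mul_assoc, ← map_mul, inv_mul_cancel₀ (by positivity), map_one, one_mul]
    rw [hXr, key]
    exact Submodule.smul_mem _ _ (mul_pow_mem_of_products_mem _ _ hpq (by omega))
  rw [as_sum_range' D (n + 1) (Nat.lt_succ_of_le hD)]
  refine Submodule.sum_mem _ fun r hr => ?_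
  rw [mem_range] at hr
  rw [← C_mul_X_pow_eq_monomial, ← smul_eq_C_mul]
  exact Submodule.smul_mem _ _ (hX r (by omega))

end ShadowBound

end

end Literature.InformationTheory.QuantumCodes
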